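import Mathlib

/-!
# Noncritical Belyi maps on `ℙ¹`: composing a Belyi pair with a rational map `g = U/V`
# in the `(p, q) ∈ ℚ[x]²` format ("protect a finite set by the poles of `g`")

Scherr–Zieve, *Separated Belyi maps* [cite: ScherrZieve2014], proof of Thm. 1 / Prop. 4: to protect
a finite set `T` one composes with a map `φ₁` sending `T` to `∞` by SIMPLE poles and then applies a
Belyi map protecting `∞` (in genus `0`, `φ₁` is an explicit rational function).  In the tree a
rational function on `ℙ¹_ℚ` is a pair of polynomials, so for `F ∈ ℚ[x]` of degree `≤ d` and
`g = U/V` the composite `F ∘ g`, cleared of denominators, is the HOMOGENISED SUBSTITUTION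

  `H_d(F; U, V) := Σ_{j ≤ d} F_j · U^j · V^{d − j}`  (`= V^d · F(U/V)` off the zeros of `V`).

This file is the bookkeeping for `H_d` with general `U, V ∈ ℚ[x]` (the Möbius special case
`U = b x`, `V = x + c` is `NoncriticalBelyiMoebius.lean`), in the normalisation `U` monic of degree
`k + 1`, `V` monic of degree `k` (so `g(∞) = ∞` simply): evaluation off/at the zeros of `V`, the top
two coefficients of `H_d(F)` (`F_d` and `d·u·F_d + F_{d−1}`, `u` the next coefficient of `U`), the
Wronskian chain rule at points with `V ≠ 0`, and — the new point — NON-RAMIFICATION of the composite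
AT THE SIMPLE ZEROS OF `V` when the pair `(P, Q)` is unramified at `∞` (reversed polynomials and the
chain rule for `1/g = V/U`).  No definitions, no named facts.
-/

namespace Literature.NumberTheory.DiophantineGeometry

open Polynomial Finset

namespace NoncriticalBelyi

variable (F : ℚ[X]) (d : ℕ) (U V : ℚ[X])

/-- Evaluation off the zeros of `V`: `H_d(F; U, V)(z) = V(z)^d · F(U(z)/V(z))`.
[cite: ScherrZieve2014, Thm 1 (proof, composition with φ₁)] -/
theorem aeval_homSubst₂ {A : Type*} [Field A] [Algebra ℚ A] (hF : F.natDegree ≤ d) (z : A)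
    (hz : aeval z V ≠ 0) :
    aeval z (∑ j ∈ range (d + 1), C (F.coeff j) * U ^ j * V ^ (d - j)) =
      (aeval z V) ^ d * aeval (aeval z U / aeval z V) F := by
  rw [map_sum, aeval_eq_sum_range' (Nat.lt_succ_of_le hF) (aeval z U / aeval z V), mul_sum]
  refine sum_congr rfl fun j hj => ?_
  rw [mem_range] at hj
  simp only [map_mul, map_pow, aeval_C, Algebra.smul_def]
  have hsplit : (aeval z V) ^ d = (aeval z V) ^ (d - j) * (aeval z V) ^ j := by
    rw [← pow_add, Nat.sub_add_cancel (by omega)]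
  have hzj : (aeval z V) ^ j ≠ 0 := pow_ne_zero j hz
  rw [hsplit, div_pow]
  field_simp

/-- At a zero `z` of `V`: `H_d(F; U, V)(z) = F_d · U(z)^d`.
[cite: ScherrZieve2014, Thm 1 (proof, composition with φ₁)] -/
theorem aeval_homSubst₂_of_root {A : Type*} [Field A] [Algebra ℚ A] (z : A) (hz : aeval z V = 0) :
    aeval z (∑ j ∈ range (d + 1), C (F.coeff j) * U ^ j * V ^ (d - j)) =
      algebraMap ℚ A (F.coeff d) * (aeval z U) ^ d := by
  rw [map_sum, sum_range_succ, sum_eq_zero, zero_add]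
  · simp only [map_mul, map_pow, aeval_C, Nat.sub_self, pow_zero, mul_one]
  · intro j hj
    rw [mem_range] at hj
    simp only [map_mul, map_pow, aeval_C, hz, zero_pow (Nat.sub_ne_zero_of_lt hj), mul_zero]

section Coeff

variable {k : ℕ} (hU : U.Monic) (hUdeg : U.natDegree = k + 1) (hV : V.Monic)
  (hVdeg : V.natDegree = k)
include hU hUdeg hV hVdeg

/-- `U^j V^{d−j}` is monic of degree `d k + j`. [folklore] -/
private theorem monic_natDegree_term (j : ℕ) (hj : j ≤ d) :
    (U ^ j * V ^ (d - j)).Monic ∧ (U ^ j * V ^ (d - j)).natDegree = d * k + j := by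
  refine ⟨(hU.pow j).mul (hV.pow _), ?_⟩
  rw [(hU.pow j).natDegree_mul (hV.pow _), hU.natDegree_pow, hV.natDegree_pow, hUdeg, hVdeg]
  have : j ≤ d := hj
  zify [this]; ring

/-- `deg H_d(F; U, V) ≤ d(k + 1)`. [cite: ScherrZieve2014, Thm 1 (proof, composition with φ₁)] -/
theorem homSubst₂_natDegree_le :
    (∑ j ∈ range (d + 1), C (F.coeff j) * U ^ j * V ^ (d - j)).natDegree ≤ d * (k + 1) := by
  refine natDegree_sum_le_of_forall_le _ _ fun j hj => ?_
  rw [mem_range] at hj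
  rw [mul_assoc]
  refine (natDegree_C_mul_le _ _).trans ?_
  rw [(monic_natDegree_term d U V hU hUdeg hV hVdeg j (by omega)).2]
  nlinarith

/-- Top coefficient: `H_d(F; U, V)_{d(k+1)} = F_d`.
[cite: ScherrZieve2014, Thm 1 (proof, composition with φ₁)] -/
theorem homSubst₂_coeff_top :
    (∑ j ∈ range (d + 1), C (F.coeff j) * U ^ j * V ^ (d - j)).coeff (d * (k + 1)) = F.coeff d := by
  rw [finsetSum_coeff, sum_range_succ, sum_eq_zero, zero_add]
  · obtain ⟨hm, hdeg⟩ := monic_natDegree_term d U V hU hUdeg hV hVdeg d le_rfl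
    rw [mul_assoc, coeff_C_mul, show d * (k + 1) = d * k + d by ring, ← hdeg, hm.coeff_natDegree,
      mul_one]
  · intro j hj
    rw [mem_range] at hj
    obtain ⟨hm, hdeg⟩ := monic_natDegree_term d U V hU hUdeg hV hVdeg j (by omega)
    rw [mul_assoc, coeff_C_mul, coeff_eq_zero_of_natDegree_lt
      (show (U ^ j * V ^ (d - j)).natDegree < d * (k + 1) by rw [hdeg]; nlinarith), mul_zero]

/-- Next coefficient (for `d ≥ 1`): `H_d(F; U, V)_{d(k+1) − 1} = F_d · (d · u) + F_{d−1}`, with `u`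
the next-to-top coefficient of `U`. [cite: ScherrZieve2014, Thm 1 (proof, composition with φ₁)] -/
theorem homSubst₂_coeff_pred (hd : 1 ≤ d) :
    (∑ j ∈ range (d + 1), C (F.coeff j) * U ^ j * V ^ (d - j)).coeff (d * (k + 1) - 1) =
      F.coeff d * (d * U.nextCoeff) + F.coeff (d - 1) := by
  obtain ⟨d', rfl⟩ : ∃ d', d = d' + 1 := ⟨d - 1, by omega⟩
  simp only [Nat.add_sub_cancel]
  rw [finsetSum_coeff, sum_range_succ, sum_range_succ, sum_eq_zero, zero_add]
  · -- the terms `j = d'` and `j = d' + 1`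
    obtain ⟨hm1, hdeg1⟩ := monic_natDegree_term (d' + 1) U V hU hUdeg hV hVdeg d' (by omega)
    obtain ⟨hm2, hdeg2⟩ := monic_natDegree_term (d' + 1) U V hU hUdeg hV hVdeg (d' + 1) le_rfl
    have hidx1 : (d' + 1) * (k + 1) - 1 = (d' + 1) * k + d' := by
      rw [show (d' + 1) * (k + 1) = (d' + 1) * k + d' + 1 by ring]; omega
    rw [mul_assoc, coeff_C_mul, mul_assoc, coeff_C_mul, hidx1]
    -- `j = d'`: top coefficient of a monic polynomial of degree `(d'+1)k + d'`
    rw [← hdeg1, hm1.coeff_natDegree, hdeg1]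
    -- `j = d' + 1`: next coefficient of the monic `U^(d'+1) V^0`
    have hnext : (U ^ (d' + 1) * V ^ (d' + 1 - (d' + 1))).coeff ((d' + 1) * k + d') =
        ((d' + 1 : ℕ) : ℚ) * U.nextCoeff := by
      have hpos : 0 < (U ^ (d' + 1) * V ^ (d' + 1 - (d' + 1))).natDegree := by rw [hdeg2]; omega
      have := nextCoeff_of_natDegree_pos hpos
      rw [hdeg2, show (d' + 1) * k + (d' + 1) - 1 = (d' + 1) * k + d' by omega] at this
      rw [← this, Nat.sub_self, pow_zero, mul_one, hU.nextCoeff_pow, nsmul_eq_mul]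
    rw [hnext]; push_cast; ring
  · intro j hj
    rw [mem_range] at hj
    obtain ⟨hm, hdeg⟩ := monic_natDegree_term (d' + 1) U V hU hUdeg hV hVdeg j (by omega)
    have hlt : (U ^ j * V ^ (d' + 1 - j)).natDegree < (d' + 1) * (k + 1) - 1 := by
      rw [hdeg, show (d' + 1) * (k + 1) - 1 = (d' + 1) * k + d' by
        rw [show (d' + 1) * (k + 1) = (d' + 1) * k + d' + 1 by ring]; omega]
      omega
    rw [mul_assoc, coeff_C_mul, coeff_eq_zero_of_natDegree_lt hlt, mul_zero]

end Coeff

/-! ### Ramification of the composite: complex-analytic chain rules -/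

/-- **Chain rule off the poles of `g = U/V`.**  At a complex `z` with `V(z) ≠ 0` and
`H_d(Q)(z) ≠ 0`: if the Wronskian of `(H_d P, H_d Q)` vanishes at `z`, then either `z` is a
critical point of `g` (`(U'V − UV')(z) = 0`) or the Wronskian `P'Q − PQ'` vanishes at `g(z)`.
[cite: ScherrZieve2014, Thm 1 (proof, composition with φ₁)] -/
theorem wronskian_homSubst₂_eq_zero (P Q : ℚ[X]) (hP : P.natDegree ≤ d) (hQ : Q.natDegree ≤ d)
    (z : ℂ) (hz : aeval z V ≠ 0)
    (hq : aeval z (∑ j ∈ range (d + 1), C (Q.coeff j) * U ^ j * V ^ (d - j)) ≠ 0)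
    (hW : aeval z
      (derivative (∑ j ∈ range (d + 1), C (P.coeff j) * U ^ j * V ^ (d - j)) *
          (∑ j ∈ range (d + 1), C (Q.coeff j) * U ^ j * V ^ (d - j)) -
        (∑ j ∈ range (d + 1), C (P.coeff j) * U ^ j * V ^ (d - j)) *
          derivative (∑ j ∈ range (d + 1), C (Q.coeff j) * U ^ j * V ^ (d - j))) = 0) :
    aeval z (derivative U * V - U * derivative V) = 0 ∨
      aeval (aeval z U / aeval z V) (derivative P * Q - P * derivative Q) = 0 := by
  set HP : ℚ[X] := ∑ j ∈ range (d + 1), C (P.coeff j) * U ^ j * V ^ (d - j) with hHP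
  set HQ : ℚ[X] := ∑ j ∈ range (d + 1), C (Q.coeff j) * U ^ j * V ^ (d - j) with hHQ
  set y : ℂ := aeval z U / aeval z V with hy
  have hQy : aeval y Q ≠ 0 := by
    intro h; apply hq; rw [hHQ, aeval_homSubst₂ Q d U V hQ z hz, ← hy, h, mul_zero]
  -- `f = HP/HQ` has derivative `0` at `z`
  have hf : HasDerivAt (fun x : ℂ => aeval x HP / aeval x HQ) 0 z := by
    have h := (HP.hasDerivAt_aeval z).div (HQ.hasDerivAt_aeval z) hq
    have hnum :
        aeval z (derivative HP) * aeval z HQ - aeval z HP * aeval z (derivative HQ) = 0 := by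
      rw [← hW, map_sub, map_mul, map_mul]
    rwa [hnum, zero_div] at h
  -- `g = U/V` and `(P/Q) ∘ g`
  have hg : HasDerivAt (fun x : ℂ => aeval x U / aeval x V)
      ((aeval z (derivative U) * aeval z V - aeval z U * aeval z (derivative V)) / (aeval z V) ^ 2)
      z := (U.hasDerivAt_aeval z).div (V.hasDerivAt_aeval z) hz
  have hcomp : HasDerivAt
      ((fun u : ℂ => aeval u P / aeval u Q) ∘ fun x : ℂ => aeval x U / aeval x V)
      ((aeval y (derivative P) * aeval y Q - aeval y P * aeval y (derivative Q)) / (aeval y Q) ^ 2 *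
        ((aeval z (derivative U) * aeval z V - aeval z U * aeval z (derivative V)) /
          (aeval z V) ^ 2)) z := by
    have hPQ : HasDerivAt (fun u : ℂ => aeval u P / aeval u Q)
        ((aeval y (derivative P) * aeval y Q - aeval y P * aeval y (derivative Q)) /
          (aeval y Q) ^ 2) (aeval z U / aeval z V) := by
      rw [← hy]; exact (P.hasDerivAt_aeval y).div (Q.hasDerivAt_aeval y) hQy
    exact hPQ.comp z hg
  -- `f = (P/Q) ∘ g` near `z`
  have hfg : (fun x : ℂ => aeval x HP / aeval x HQ) =ᶠ[nhds z]
      ((fun u : ℂ => aeval u P / aeval u Q) ∘ fun x : ℂ => aeval x U / aeval x V) := by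
    have hopen : IsOpen {x : ℂ | aeval x V ≠ 0} :=
      isOpen_ne_fun (V.continuous_aeval) continuous_const
    filter_upwards [hopen.mem_nhds hz] with x hx
    have hxd : (aeval x V) ^ d ≠ 0 := pow_ne_zero _ hx
    simp only [Function.comp_apply, hHP, hHQ, aeval_homSubst₂ P d U V hP x hx,
      aeval_homSubst₂ Q d U V hQ x hx]
    rw [mul_div_mul_left _ _ hxd]
  have huniq := (hf.unique (hcomp.congr_of_eventuallyEq hfg)).symm
  rw [mul_eq_zero, div_eq_zero_iff, div_eq_zero_iff] at huniq
  rw [map_sub, map_mul, map_mul, map_sub, map_mul, map_mul]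
  rcases huniq with (h | h) | (h | h)
  · exact Or.inr h
  · exact absurd h (pow_ne_zero _ hQy)
  · exact Or.inl h
  · exact absurd h (pow_ne_zero _ hz)

/-- **Non-ramification at the simple poles of `g = U/V`.**  At a complex `z` with `V(z) = 0`,
`V'(z) ≠ 0`, `U(z) ≠ 0` (a simple pole of `g`), for `P, Q` of degree `≤ d` with `Q_d ≠ 0` and
`P_{d−1} Q_d ≠ P_d Q_{d−1}` (`P/Q` unramified at `∞` with finite nonzero value... `≠ Q`-pole), the
Wronskian of `(H_d P, H_d Q)` does NOT vanish at `z` — the composite `(P/Q) ∘ g` is unramified at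
the pole `z`.  Proof: near `z`, `H_d(F)(x) = U(x)^d · F^rev(V(x)/U(x))` with
`F^rev = Σ F_j t^{d−j}`, and
`(P^rev/Q^rev)'(0) = (P_{d−1}Q_d − P_d Q_{d−1})/Q_d²`.
[cite: ScherrZieve2014, Thm 1 (proof, composition with φ₁)] -/
theorem wronskian_homSubst₂_ne_zero_of_pole (P Q : ℚ[X]) (hP : P.natDegree ≤ d)
    (hQ : Q.natDegree ≤ d) (hd : 1 ≤ d) (hQd : Q.coeff d ≠ 0)
    (hunr : P.coeff (d - 1) * Q.coeff d ≠ P.coeff d * Q.coeff (d - 1))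
    (z : ℂ) (hVz : aeval z V = 0) (hV'z : aeval z (derivative V) ≠ 0) (hUz : aeval z U ≠ 0) :
    aeval z
      (derivative (∑ j ∈ range (d + 1), C (P.coeff j) * U ^ j * V ^ (d - j)) *
          (∑ j ∈ range (d + 1), C (Q.coeff j) * U ^ j * V ^ (d - j)) -
        (∑ j ∈ range (d + 1), C (P.coeff j) * U ^ j * V ^ (d - j)) *
          derivative (∑ j ∈ range (d + 1), C (Q.coeff j) * U ^ j * V ^ (d - j))) ≠ 0 := by
  set HP : ℚ[X] := ∑ j ∈ range (d + 1), C (P.coeff j) * U ^ j * V ^ (d - j) with hHP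
  set HQ : ℚ[X] := ∑ j ∈ range (d + 1), C (Q.coeff j) * U ^ j * V ^ (d - j) with hHQ
  -- reversed polynomials
  set RP : ℚ[X] := ∑ j ∈ range (d + 1), C (P.coeff j) * X ^ (d - j) with hRP
  set RQ : ℚ[X] := ∑ j ∈ range (d + 1), C (Q.coeff j) * X ^ (d - j) with hRQ
  -- `H(F)(x) = U(x)^d · F^rev(V x / U x)` where `U x ≠ 0`
  have hrev : ∀ (G : ℚ[X]) (x : ℂ), aeval x U ≠ 0 →
      aeval x (∑ j ∈ range (d + 1), C (G.coeff j) * U ^ j * V ^ (d - j)) =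
        (aeval x U) ^ d *
          aeval (aeval x V / aeval x U) (∑ j ∈ range (d + 1), C (G.coeff j) * X ^ (d - j)) := by
    intro G x hx
    rw [map_sum, map_sum, mul_sum]
    refine sum_congr rfl fun j hj => ?_
    rw [mem_range] at hj
    simp only [map_mul, map_pow, aeval_C, aeval_X]
    have hsplit : (aeval x U) ^ d = (aeval x U) ^ j * (aeval x U) ^ (d - j) := by
      rw [← pow_add, Nat.add_sub_cancel' (by omega)]
    rw [hsplit, div_pow]
    field_simp
  -- values of `F^rev` and its derivative at `0`
  have hrev0 : ∀ G : ℚ[X], aeval (0 : ℂ) (∑ j ∈ range (d + 1), C (G.coeff j) * X ^ (d - j)) =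
      algebraMap ℚ ℂ (G.coeff d) := by
    intro G
    rw [map_sum, sum_range_succ, sum_eq_zero, zero_add]
    · simp
    · intro j hj; rw [mem_range] at hj
      simp [zero_pow (Nat.sub_ne_zero_of_lt hj)]
  have hrev1 : ∀ G : ℚ[X],
      aeval (0 : ℂ) (derivative (∑ j ∈ range (d + 1), C (G.coeff j) * X ^ (d - j))) =
        algebraMap ℚ ℂ (G.coeff (d - 1)) := by
    intro G
    rw [derivative_sum, map_sum, sum_eq_single (d - 1)]
    · rw [derivative_C_mul_X_pow, map_mul, map_pow, aeval_C, aeval_X,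
        show d - (d - 1) = 1 by omega, Nat.sub_self, pow_zero, mul_one, Nat.cast_one, mul_one]
    · intro j hj hjd
      rw [mem_range] at hj
      rw [derivative_C_mul_X_pow, map_mul, map_pow, aeval_C, aeval_X]
      rcases Nat.lt_or_ge j (d - 1) with h | h
      · rw [zero_pow (by omega), mul_zero]
      · have : j = d := by omega
        subst this
        simp
    · intro h; exact absurd (mem_range.2 (by omega)) h
  have hRQ0 : aeval (0 : ℂ) RQ ≠ 0 := by
    rw [hRQ, hrev0, map_ne_zero_iff _ (algebraMap ℚ ℂ).injective]; exact hQd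
  -- `h = V/U` near `z`: `h z = 0`, `h' z = V'(z)/U(z)`
  have hh : HasDerivAt (fun x : ℂ => aeval x V / aeval x U)
      ((aeval z (derivative V) * aeval z U - aeval z V * aeval z (derivative U)) / (aeval z U) ^ 2)
      z := (V.hasDerivAt_aeval z).div (U.hasDerivAt_aeval z) hUz
  have hhz : aeval z V / aeval z U = 0 := by rw [hVz, zero_div]
  have hh' : (aeval z (derivative V) * aeval z U - aeval z V * aeval z (derivative U)) /
      (aeval z U) ^ 2 ≠ 0 := by
    rw [hVz, zero_mul, sub_zero]
    exact div_ne_zero (mul_ne_zero hV'z hUz) (pow_ne_zero _ hUz)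
  -- `(RP/RQ) ∘ h` and its derivative at `z`
  have hcomp : HasDerivAt
      ((fun t : ℂ => aeval t RP / aeval t RQ) ∘ fun x : ℂ => aeval x V / aeval x U)
      ((aeval 0 (derivative RP) * aeval 0 RQ - aeval 0 RP * aeval 0 (derivative RQ)) /
          (aeval (0 : ℂ) RQ) ^ 2 *
        ((aeval z (derivative V) * aeval z U - aeval z V * aeval z (derivative U)) /
          (aeval z U) ^ 2)) z := by
    have h1 : HasDerivAt (fun t : ℂ => aeval t RP / aeval t RQ)
        ((aeval 0 (derivative RP) * aeval 0 RQ - aeval 0 RP * aeval 0 (derivative RQ)) /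
          (aeval (0 : ℂ) RQ) ^ 2) (aeval z V / aeval z U) := by
      rw [hhz]; exact (RP.hasDerivAt_aeval 0).div (RQ.hasDerivAt_aeval 0) hRQ0
    exact h1.comp z hh
  -- `HP/HQ = (RP/RQ) ∘ h` near `z`
  have hfg : (fun x : ℂ => aeval x HP / aeval x HQ) =ᶠ[nhds z]
      ((fun t : ℂ => aeval t RP / aeval t RQ) ∘ fun x : ℂ => aeval x V / aeval x U) := by
    have hopen : IsOpen {x : ℂ | aeval x U ≠ 0} :=
      isOpen_ne_fun (U.continuous_aeval) continuous_const
    filter_upwards [hopen.mem_nhds hUz] with x hx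
    simp only [Function.comp_apply, hHP, hHQ, hrev P x hx, hrev Q x hx]
    rw [mul_div_mul_left _ _ (pow_ne_zero _ hx)]
  -- if the Wronskian vanished, `HP/HQ` would have derivative `0` at `z`
  intro hW
  have hHQz : aeval z HQ ≠ 0 := by
    rw [hHQ, hrev Q z hUz, hhz]
    exact mul_ne_zero (pow_ne_zero _ hUz) hRQ0
  have hf : HasDerivAt (fun x : ℂ => aeval x HP / aeval x HQ) 0 z := by
    have h := (HP.hasDerivAt_aeval z).div (HQ.hasDerivAt_aeval z) hHQz
    have hnum :
        aeval z (derivative HP) * aeval z HQ - aeval z HP * aeval z (derivative HQ) = 0 := by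
      rw [← hW, map_sub, map_mul, map_mul]
    rwa [hnum, zero_div] at h
  have huniq := (hf.unique (hcomp.congr_of_eventuallyEq hfg)).symm
  rw [mul_eq_zero] at huniq
  rcases huniq with h | h
  · rw [div_eq_zero_iff] at h
    rcases h with h | h
    · rw [hRP, hRQ, hrev0, hrev0, hrev1, hrev1, ← map_mul, ← map_mul, ← map_sub,
        map_eq_zero_iff _ (algebraMap ℚ ℂ).injective, sub_eq_zero] at h
      exact hunr h
    · exact pow_ne_zero _ hRQ0 h
  · exact hh' h

end NoncriticalBelyi

end Literature.NumberTheory.DiophantineGeometry
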